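import Summits.Ventures.CertifiedManyBodySolver.Certificates.HubbardSquare_LaBoxE_n1_boxdual_inner29o5_pinS1_K
import HarnessLib

/-!
# Ventures/CertifiedManyBodySolver — Theorems/CovLa214M2bSegmentFanCeilingEditionK.lean: K1 «SegmentFanCeiling» EDITION K — CLOSED MODULO ONE NODE

Item stmt-Ventures-26183 `SegmentFanCeiling` (crux K1, rank 2) of route `route-Ventures-CovLa214M2b` (route pen hubbard-m2-certneg-1; HELD «closed modulo nodes»: edition W
closer of record `Theorems.covLa214M2b_SegmentFanCeiling_of_nodes`, p634911, SEVEN claim nodes). La214 captain RULING «TWO DISCHARGE TIERS PER K-ITEM» (obs STATUS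
2026-08-28T13:20:31Z) / route pen (α″) «hold needs = the minimum over accepted closers» (13:31:37Z): EDITION K = the inner pinned pair (kit j306415: hub j298764 +
S1 spoke j303210) RE-PRICED at the KERNEL energy window (band-bottom floor `−4(1+s)`, `2 × 4`-cluster cap plane) — node `cert_laBoxE_inner29o5_pinS1_K_up`
(value `F0′ = −1254019830679295715951510116321/2951479051793528258560000000000`, word `0.4248785 ≤ 0.4364687`) — and `SegmentFanCeiling` follows from THAT NODE ALONE
(engine `covLa214M2b_SegmentFanCeiling_of_kernelWindow`, p637073, hubbard-obs-p2 g19). ZERO compute in this file.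
HONEST FRAMING: a one-sided certified stiffness-scale CEILING word on a downfolded one-band box (D-0150 M2(b); wording class (xx1): CONTROL / CALIBRATION + labelled
heuristic), conditional BY NAME on ONE certificate claim node (a pinned-pair SDP dual certificate, reader-checked, not kernel); the registry word of record (edition W,
0.3870869) is untouched; a ceiling never speaks to the presence of superconductivity or to `ρ_s = 0`; never «certified true negative»; not a `T_c` or phase sentence;
nothing here is a statement about superconductivity in La₂CuO₄; no summit statement is proved.
References: T. Koma, H. Tasaki, J. Stat. Phys. 76 (1994) 745, §1 [KomaTasaki1994]; D. J. Scalapino, S. R. White, S.-C. Zhang, PRB 47 (1993) 7995, §II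
[ScalapinoWhiteZhang1993].
-/

namespace Summit.Ventures.CertifiedManyBodySolver.Theorems

open Summit.Ventures.CertifiedManyBodySolver.Theses.CovLa214M2b
open Summit.Ventures.CertifiedManyBodySolver.Certificates

/-- **K1 «SegmentFanCeiling» (stmt-Ventures-26183), EDITION K — CLOSED MODULO ONE NODE**: the re-priced inner pinned-pair node `cert_laBoxE_inner29o5_pinS1_K_up`
⇒ `SegmentFanCeiling`; energy window, `D₄` symmetrisation, apex transport and the torus → thermodynamic-limit passage are kernel theorems. [cite: KomaTasaki1994, §1] [cite: ScalapinoWhiteZhang1993, §II] -/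
theorem covLa214M2b_SegmentFanCeiling_of_kernelWindow_pinS1 (h : cert_laBoxE_inner29o5_pinS1_K_up) : SegmentFanCeiling :=
  covLa214M2b_SegmentFanCeiling_of_pinS1_K h

/-- The edition-K word in 7-dp UP decimals: `−F0′ ≤ 4248785/10⁷ ≤ 4364687/10⁷`. [folklore] -/
theorem covLa214M2b_SegmentFanCeiling_editionK_word : (-((-1254019830679295715951510116321 / 2951479051793528258560000000000 : ℚ)) ≤ 4248785 / 10000000) ∧
    ((4248785 / 10000000 : ℚ) ≤ 4364687 / 10000000) := by
  norm_num

end Summit.Ventures.CertifiedManyBodySolver.Theorems
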